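import Summits.NavierStokesRegularity.FunctionalMining.NoGo.TopBotEigSplitShareWallLine
import Summits.NavierStokesRegularity.FunctionalMining.NoGo.TopBotEigSplitShareNecessity
import HarnessLib

/-!
# FunctionalMining / NoGo — K16: the share of a convex splitting of the symmetrised top–bottom density is
# at most the axisymmetric share `c_axi(q)`, every real `q > 1` (the general-`q` necessity half of the share
# window; K14 is the value `q = 4`)

HONEST FRAMING. Search for candidate a priori estimates; no regularity claim. Nothing about Navier–Stokes is
proved or asserted in this file: a finite-dimensional statement about convex functions on flat `3 × 3`
tensors, proved with one-variable calculus (real powers). Cell `pub-nsfunc`, no-go seat (gen 43), kernel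
candidate K16 (one file; LEAD STATUS l.9 "the q ≠ 4 share-necessity profile c*(q)", HANDOFF 159 (d)/160 (2)).

THE TARGET. K9 `NoGo/TopBotEigHeatCoerciveSplit` typed `TopEig.TopBotEigSplitting q c`: `∃ M ≥ 0` and a convex
`1`-Lipschitz `h ≥ 0` with `λ(A)^q + λ(−A)^q = M·h(A)^q + c·‖A‖^q` on symmetric trace-free `A`; K10c
`NoGo/TopBotEigSplitting` proved it for every real `q ≥ 2` with the share `shareConst q > 0`; K14
`NoGo/TopBotEigSplitShareNecessity` proved the necessity `c ≤ 2/9` at `q = 4`. The dictionary (block 55,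
DICTIONARY l.244; three pen hands: census-1 (cc.151), census-2, nogo) names the optimal share on the test line
for every `q`: **`c_axi(q) = ½[(S_q + B_q) − √((S_q − B_q)² + 4R_q)]`, `S_q = (2^q + 1)·6^{−q/2}`,
`B_q = ((q−1)/2)·6^{1−q/2}`, `R_q = ((q−1)/2)·6^{1−q}`** (`c_axi(2) = 1/3`, `c_axi(3) = (5√6 − √22)/24`,
`c_axi(4) = 2/9`). This file proves the NECESSITY in the kernel for every real `q > 1`:
**`TopEig.topBotEigSplitting_share_le_cAxi (hq : 1 < q) : TopBotEigSplitting q c → c ≤ cAxi q`**, with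
`cAxi` the displayed closed form (`TopEig.cAxi`, `axiS`, `axiB`, `axiR`); `not_topBotEigSplitting_of_cAxi_lt`;
with the tree's K10c the two-sided window **`shareConst_le_cAxi (hq : 2 ≤ q) : shareConst q ≤ cAxi q`**,
`share_window_cAxi`; `cAxi_pos (hq : 1 < q) : 0 < cAxi q`, `cAxi_lt_axiS`; and BY VALUE `cAxi_two : cAxi 2 = 1/3`
(the share of K7's pointwise identity `λ₁² + λ₃² = ‖S‖²/3 + (4/3)g²`), `cAxi_four : cAxi 4 = 2/9` (K14's
constant, so K14's theorem is recovered as the `example` of §8), `cAxi_three : cAxi 3 = (5√6 − √22)/24`.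

MECHANISM [ours] (K14's test line, real powers). §1 The constants in the atoms `P = 2^{q/2}`, `Q = 3^{q/2}`
(`axiP`, `axiQ`): `S_q = (P² + 1)/(PQ)`, `B_q = 3(q−1)/(PQ)`, `R_q = 3(q−1)/(PQ)²` (`axiS_eq`, `axiB_eq`,
`axiR_eq`). §2 Along K14's line `A(u) = diag(u, 1 − 2u,
u − 1)` (`λ(A(u)) = u` on `u ≥ 1/3`, `λ(−A(u)) = 1 − u` on `u ≤ 2/3`, `‖A(u)‖² = 6u² − 6u + 2`) a splitting
reads `N(u) := u^q + (1 − u)^q − c(6u² − 6u + 2)^{q/2} = M·g(u)^q` on `[1/3, 2/3]`, `g = h ∘ A` convex on `ℝ`,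
`g ≥ 0` (`lineN`); the closed forms `N′`, `N″` on `(0, 1)` (`lineN1`, `lineN2`) and `T := q·N·N″ − (q−1)·N′²`
(`lineT`). §3 THE WALL VALUES at
`u = 2/3`: `N(2/3) = N(1/3) = (P/Q)(S_q − c)` and the identity **`T(2/3) = (27/4)q²(P/Q)²·[(c − (S_q+B_q)/2)²
− ((S_q−B_q)² + 4R_q)/4]`**, whose smaller root in `c` is `c_axi(q)`; since `(S_q − r₁)(S_q − r₂) = −R_q < 0`,
`T(2/3) < 0` for every `c_axi(q) < c ≤ S_q`. §4 WALL LEMMA (every real `q > 1`): `M > 0`, `N(2/3) > 0`,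
`T(2/3) < 0` are incompatible with a convex `g ≥ 0`, `M g^q = N` on `[1/3, 2/3]`: on a left neighbourhood of
the wall `g = (N/M)^{1/q}` is differentiable with derivative `φ = (N′/M)(1/q)(N/M)^{1/q−1}`, convexity makes
`deriv g = φ` monotone (`ConvexOn.monotoneOn_deriv`), so `0 ≤ deriv φ` at an interior point
(`MonotoneOn.derivWithin_nonneg`), but `deriv φ = (N/M)^{1/q−2}·T/(q²M²) < 0`. §5 THE FLAT CASE: if `N ≡ 0` on
`[1/3, 2/3]` then `N′ ≡ 0` on `(1/3, 2/3)` (derivative of a locally constant function), so `N′(2/3) = 0` by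
continuity and `T(2/3) = 0`. §6 ASSEMBLY: `M g(2/3)^q = N(2/3) ≥ 0` forces `c ≤ S_q`; if `c_axi(q) < c` then
`T(2/3) < 0`, so `N ≢ 0` on `[1/3, 2/3]` (§5), whence `M > 0` and `c < S_q` (at `c = S_q`, `g(1/3) = g(2/3) =
0` and convexity flatten `g`, hence `N`, on `[1/3, 2/3]`), and §4 closes.

NOT CLAIMED. Sufficiency AT `c = c_axi(q)` (a splitting with share exactly `c_axi(q)`) is the census pen, not
this file; the tree's proved share stays K10c's `shareConst q` (`q ≥ 2`). No statement on `heatDissipation`,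
no Navier–Stokes statement, no `𝒦₀` row, no count, no numerics. References: K14 (`lineTens`, `lam_lineTens`,
`lam_neg_lineTens`, `norm_sq_lineTens`, `lineTens_affine`, `lineTens_symm`, `lineTens_trace`), K9
(`TopBotEigSplitting`), K10b/c (`shareConst`, `shareConst_pos`, `topBotEigSplitting_shareConst`) through K14's
imports; Mathlib `HasDerivAt.rpow_const`, `ContinuousAt.rpow_const`, `Real.rpow_rpow_inv`,
`ConvexOn.monotoneOn_deriv`, `MonotoneOn.derivWithin_nonneg`, `derivWithin_of_isOpen`.

FILEABLE FORM (400-line lint: every tree file ≤ 399 lines) — PART 2 of 2 of the staged monolith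
`NoGo/TopBotEigSplitShareWall.STAGING.lean` 22c1960263dbb788 (661 l.): this file = its sections from `## 4.` to the end
(declarations byte-identical, same order) and imports PART 1 `NoGo/TopBotEigSplitShareWallLine.lean` (the earlier sections).
search for candidate a priori estimates; no regularity claim.
FILING (prove seat g26, REQUEST #31′ part 2 of 2 (nogo g43 touch 4, HOME INBOX l.4686: two-part pure cut of the certified monolith `TopBotEigSplitShareWall.STAGING.lean` 22c1960263dbb788 for the 400-line lint; LEAD RULING (ηη) slot #31)): declarations byte-identical to the no-go seat's staged `TopBotEigSplitShareWallMain.STAGING.lean` 434d29f64bbbee1a; this line is the only addition.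
-/

open Set Filter Topology

noncomputable section

namespace Summit.NavierStokesRegularity.FunctionalMining

namespace TopEig

/-! ## 4. The wall lemma, every real `q > 1`: no convex `q`-th root -/

/-- **Wall lemma (real `q > 1`).** If `M > 0`, `N(2/3) > 0`, `T(2/3) < 0`, `g` is convex on `ℝ`, `g ≥ 0`,
and `M g(u)^q = N(u)` on `[1/3, 2/3]`, contradiction: `g = (N/M)^{1/q}` is twice differentiable to the
left of the wall with `g″ = (N/M)^{1/q − 2}·T/(q²M²) < 0`. [ours] -/
theorem wall_lemma_rpow {q c M : ℝ} (hq : 1 < q) (hM : 0 < M) (hN : 0 < lineN q c (2 / 3))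
    (hT : lineT q c (2 / 3) < 0) {g : ℝ → ℝ} (hg : ConvexOn ℝ univ g) (hg0 : ∀ u, 0 ≤ g u)
    (hid : ∀ u : ℝ, 1 / 3 ≤ u → u ≤ 2 / 3 → M * g u ^ q = lineN q c u) : False := by
  have hq0 : q ≠ 0 := by positivity
  obtain ⟨δ, hδ, hδ3, hnb⟩ := exists_nhds_wall_rpow hN hT
  -- the open interval to the left of the wall
  set S : Set ℝ := Ioo (2 / 3 - δ) (2 / 3) with hS
  have hSwall : ∀ u ∈ S, |u - 2 / 3| < δ := fun u hu => by
    rw [abs_lt]; constructor <;> linarith [hu.1, hu.2]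
  have hSI : ∀ u ∈ S, 1 / 3 ≤ u ∧ u ≤ 2 / 3 := fun u hu => ⟨by linarith [hu.1], hu.2.le⟩
  have hS01 : ∀ u ∈ S, 0 < u ∧ u < 1 := fun u hu => ⟨by linarith [hu.1], by linarith [hu.2]⟩
  -- `Pf = N/M`, `G = Pf^{1/q}`
  set Pf : ℝ → ℝ := fun u => lineN q c u / M with hPf
  have hPpos : ∀ u ∈ S, 0 < Pf u := fun u hu => div_pos (hnb u (hSwall u hu)).1 hM
  have hPd : ∀ u ∈ S, HasDerivAt Pf (lineN1 q c u / M) u := fun u hu =>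
    (hasDerivAt_lineN q c (hS01 u hu).1 (hS01 u hu).2).div_const M
  set G : ℝ → ℝ := fun u => Pf u ^ (1 / q) with hG
  have hgG : ∀ u ∈ S, g u = G u := by
    intro u hu
    have hgq : g u ^ q = Pf u := by
      simp only [hPf]; rw [← hid u (hSI u hu).1 (hSI u hu).2]; field_simp
    simp only [hG]; rw [← hgq, one_div, Real.rpow_rpow_inv (hg0 u) hq0]
  -- the explicit derivative of `G`
  set φ : ℝ → ℝ := fun u => lineN1 q c u / M * (1 / q) * Pf u ^ (1 / q - 1) with hφ
  have hGd : ∀ u ∈ S, HasDerivAt G (φ u) u := fun u hu =>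
    (hPd u hu).rpow_const (Or.inl (hPpos u hu).ne')
  have hgd : ∀ u ∈ S, HasDerivAt g (φ u) u := by
    intro u hu
    refine (hGd u hu).congr_of_eventuallyEq ?_
    filter_upwards [Ioo_mem_nhds hu.1 hu.2] with y hy
    exact hgG y hy
  -- monotone derivative on `S`
  have hmono : MonotoneOn (deriv g) S :=
    (hg.subset (subset_univ S) (convex_Ioo _ _)).monotoneOn_deriv
      fun u hu => (hgd u hu).differentiableAt
  have hmonoφ : MonotoneOn φ S := hmono.congr fun u hu => (hgd u hu).deriv
  -- the test point
  set x : ℝ := 2 / 3 - δ / 2 with hx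
  have hxS : x ∈ S := ⟨by simp only [hx]; linarith, by simp only [hx]; linarith⟩
  have hPx : 0 < Pf x := hPpos x hxS
  have hTx : lineT q c x < 0 := (hnb x (hSwall x hxS)).2
  -- abbreviations at the test point
  set a : ℝ := lineN1 q c x / M with ha
  set b : ℝ := lineN2 q c x / M with hb
  set p : ℝ := Pf x with hp
  set e2 : ℝ := p ^ (1 / q - 2) with he2
  have he2pos : 0 < e2 := Real.rpow_pos_of_pos hPx _
  have he1 : p ^ (1 / q - 1) = p * e2 := by
    rw [he2, show 1 / q - 1 = (1 / q - 2) + 1 by ring, Real.rpow_add hPx, Real.rpow_one]; ring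
  -- derivative of `φ` at `x`
  have hd1 : HasDerivAt (fun u => lineN1 q c u / M) b x :=
    (hasDerivAt_lineN1 q c (hS01 x hxS).1 (hS01 x hxS).2).div_const M
  have hd2 : HasDerivAt (fun u => Pf u ^ (1 / q - 1)) (a * (1 / q - 1) * p ^ (1 / q - 1 - 1)) x :=
    (hPd x hxS).rpow_const (Or.inl hPx.ne')
  rw [show 1 / q - 1 - 1 = 1 / q - 2 by ring] at hd2
  have hd5 : HasDerivAt φ (b * (1 / q) * p ^ (1 / q - 1) +
      a * (1 / q) * (a * (1 / q - 1) * p ^ (1 / q - 2))) x :=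
    (hd1.mul_const (1 / q)).mul hd2
  -- monotone `φ` has a non-negative derivative at the interior point `x`
  have hderiv_nonneg : 0 ≤ derivWithin φ S x := hmonoφ.derivWithin_nonneg
  rw [derivWithin_of_isOpen isOpen_Ioo hxS, hd5.deriv, he1, ← he2] at hderiv_nonneg
  -- algebra: the derivative is `e2 · (T/M²) / q²`
  have hkey : q * p * b - (q - 1) * a ^ 2 < 0 := by
    have h1 : q * p * b - (q - 1) * a ^ 2 = lineT q c x / M ^ 2 := by
      simp only [ha, hb, hp, hPf, lineT]
      field_simp
    rw [h1]
    exact div_neg_of_neg_of_pos hTx (by positivity)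
  have hval : b * (1 / q) * (p * e2) + a * (1 / q) * (a * (1 / q - 1) * e2) =
      e2 * (q * p * b - (q - 1) * a ^ 2) / q ^ 2 := by
    field_simp
    ring
  rw [hval] at hderiv_nonneg
  exact absurd hderiv_nonneg
    (not_le.mpr (div_neg_of_neg_of_pos (mul_neg_of_pos_of_neg he2pos hkey) (by positivity)))

/-! ## 5. The flat case: `N ≡ 0` on `[1/3, 2/3]` forces `T(2/3) = 0` -/

/-- If `N ≡ 0` on `[1/3, 2/3]` then `N′(2/3) = 0` (so `T(2/3) = 0`). [bookkeeping] -/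
theorem lineT_two_thirds_eq_zero_of_flat {q c : ℝ}
    (hz : ∀ u : ℝ, 1 / 3 ≤ u → u ≤ 2 / 3 → lineN q c u = 0) : lineT q c (2 / 3) = 0 := by
  -- `N′ = 0` on the open interval
  have h1 : ∀ u ∈ Ioo (1 / 3 : ℝ) (2 / 3), lineN1 q c u = 0 := by
    intro u hu
    have hd := hasDerivAt_lineN q c (u := u) (by linarith [hu.1]) (by linarith [hu.2])
    have hev : (fun _ : ℝ => (0 : ℝ)) =ᶠ[𝓝 u] lineN q c := by
      filter_upwards [Ioo_mem_nhds hu.1 hu.2] with y hy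
      exact (hz y hy.1.le hy.2.le).symm
    have hd0 : HasDerivAt (fun _ : ℝ => (0 : ℝ)) (lineN1 q c u) u := hd.congr_of_eventuallyEq hev
    exact hd0.unique (hasDerivAt_const u 0) ▸ rfl
  -- continuity of `N′` at `2/3` from the left
  have hc1 : ContinuousAt (lineN1 q c) (2 / 3) :=
    (hasDerivAt_lineN1 q c (u := 2 / 3) (by norm_num) (by norm_num)).continuousAt
  have t1 : Tendsto (lineN1 q c) (𝓝[<] (2 / 3)) (𝓝 (lineN1 q c (2 / 3))) :=
    hc1.tendsto.mono_left nhdsWithin_le_nhds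
  have t2 : Tendsto (lineN1 q c) (𝓝[<] (2 / 3)) (𝓝 0) := by
    refine tendsto_const_nhds.congr' ?_
    filter_upwards [Ioo_mem_nhdsLT (show (1 / 3 : ℝ) < 2 / 3 by norm_num)] with y hy
    exact (h1 y hy).symm
  have hN1 : lineN1 q c (2 / 3) = 0 := tendsto_nhds_unique t1 t2
  have hN0 : lineN q c (2 / 3) = 0 := hz _ (by norm_num) le_rfl
  simp [lineT, hN1, hN0]

/-! ## 6. The necessity of the share `c ≤ c_axi(q)`, every real `q > 1` -/

/-- `‖A‖^q = (‖A‖²)^{q/2}`. [bookkeeping] -/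
theorem rpow_eq_sq_rpow_half {a : ℝ} (ha : 0 ≤ a) (q : ℝ) : a ^ q = (a ^ 2) ^ (q / 2) := by
  rw [← Real.rpow_natCast_mul ha 2 (q / 2)]; congr 1; push_cast; ring

/-- **Sharp-share necessity, every real `q > 1`.** Every convex `1`-Lipschitz non-negative splitting
`λ(A)^q + λ(−A)^q = M h(A)^q + c‖A‖^q` of the symmetrised top–bottom density on symmetric trace-free
`3 × 3` tensors has share `c ≤ c_axi(q)`. Search for candidate a priori estimates; no regularity claim.
[ours; the necessity half of the share window, general `q`] -/
theorem topBotEigSplitting_share_le_cAxi {q c : ℝ} (hq : 1 < q) (hs : TopBotEigSplitting q c) :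
    c ≤ cAxi q := by
  have hq0 : q ≠ 0 := by positivity
  have hP := axiP_pos q; have hQ := axiQ_pos q
  obtain ⟨M, hM, h, hconv, -, hall⟩ := hs
  set g : ℝ → ℝ := fun u => h (lineTens u) with hg
  have hg0 : ∀ u, 0 ≤ g u := fun u => (hall _ (lineTens_symm u) (lineTens_trace u)).1
  have hid : ∀ u : ℝ, 1 / 3 ≤ u → u ≤ 2 / 3 → M * g u ^ q = lineN q c u := by
    intro u hu1 hu2
    have h2 := (hall _ (lineTens_symm u) (lineTens_trace u)).2
    rw [lam_lineTens hu1, lam_neg_lineTens hu2, rpow_eq_sq_rpow_half (norm_nonneg _), norm_sq_lineTens]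
      at h2
    simp only [hg, lineN, lineNsq]
    linarith
  have hgc : ConvexOn ℝ univ g := by
    refine ⟨convex_univ, fun x _ y _ a b ha hb hab => ?_⟩
    simp only [hg, smul_eq_mul]
    rw [lineTens_affine hab]
    exact hconv.2 (mem_univ _) (mem_univ _) ha hb hab
  by_contra hc
  rw [not_le] at hc
  have e23 := hid (2 / 3) (by norm_num) le_rfl
  have e13 := hid (1 / 3) le_rfl (by norm_num)
  rw [lineN_two_thirds] at e23
  rw [lineN_one_third] at e13
  -- `c ≤ S_q` from `N(2/3) = M g(2/3)^q ≥ 0`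
  have hPQ : 0 < axiP q / axiQ q := div_pos hP hQ
  have hcS : c ≤ axiS q := by
    have h0 : 0 ≤ M * g (2 / 3) ^ q := mul_nonneg hM (Real.rpow_nonneg (hg0 _) _)
    rw [e23] at h0
    nlinarith
  have hT : lineT q c (2 / 3) < 0 := lineT_two_thirds_neg hq hc hcS
  by_cases hz : ∃ u₀ : ℝ, 1 / 3 ≤ u₀ ∧ u₀ ≤ 2 / 3 ∧ lineN q c u₀ ≠ 0
  swap
  · refine absurd (lineT_two_thirds_eq_zero_of_flat fun u hu1 hu2 => ?_) hT.ne
    by_contra hne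
    exact hz ⟨u, hu1, hu2, hne⟩
  obtain ⟨u₀, hu1, hu2, hne⟩ := hz
  -- `M > 0`
  have hMpos : 0 < M := by
    rcases hM.eq_or_lt with hM0 | hMpos
    · exact absurd (by rw [← hid u₀ hu1 hu2, ← hM0, zero_mul]) hne
    · exact hMpos
  -- `c < S_q`: at `c = S_q` convexity flattens `g` on `[1/3, 2/3]`
  have hcS' : c < axiS q := by
    rcases hcS.lt_or_eq with hlt | heq
    · exact hlt
    exfalso
    have hz : ∀ u, M * g u ^ q = 0 → g u = 0 := fun u hu => by
      rcases mul_eq_zero.mp hu with h0 | h0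
      · exact absurd h0 hMpos.ne'
      · exact ((Real.rpow_eq_zero_iff_of_nonneg (hg0 u)).mp h0).1
    have g23 : g (2 / 3) = 0 := hz _ (by rw [e23, heq, sub_self, mul_zero])
    have g13 : g (1 / 3) = 0 := hz _ (by rw [e13, heq, sub_self, mul_zero])
    have hmid := hgc.2 (mem_univ (1 / 3 : ℝ)) (mem_univ (2 / 3 : ℝ)) (by linarith : (0 : ℝ) ≤ 2 - 3 * u₀)
      (by linarith : (0 : ℝ) ≤ 3 * u₀ - 1) (by ring)
    simp only [smul_eq_mul, g13, g23, mul_zero, add_zero] at hmid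
    rw [show (2 - 3 * u₀) * (1 / 3 : ℝ) + (3 * u₀ - 1) * (2 / 3) = u₀ by ring] at hmid
    have g0 : g u₀ = 0 := le_antisymm hmid (hg0 _)
    have := hid u₀ hu1 hu2
    rw [g0, Real.zero_rpow hq0, mul_zero] at this
    exact hne this.symm
  have hN : 0 < lineN q c (2 / 3) := by rw [lineN_two_thirds]; exact mul_pos hPQ (by linarith)
  exact wall_lemma_rpow hq hMpos hN hT hgc hg0 hid

/-- The same statement with the obligation written out (no tree constant but `TopEig.lam`).
[ours; bookkeeping] -/
theorem share_le_cAxi_of_convex_splitting {q c M : ℝ} (hq : 1 < q) (hM : 0 ≤ M)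
    {h : EuclideanSpace ℝ (Fin 3 × Fin 3) → ℝ} (hconv : ConvexOn ℝ univ h) (hlip : LipschitzWith 1 h)
    (hall : ∀ A : EuclideanSpace ℝ (Fin 3 × Fin 3), (∀ i j, A (i, j) = A (j, i)) →
      ∑ i, A (i, i) = 0 → 0 ≤ h A ∧ lam A ^ q + lam (-A) ^ q = M * h A ^ q + c * ‖A‖ ^ q) :
    c ≤ cAxi q :=
  topBotEigSplitting_share_le_cAxi hq ⟨M, hM, h, hconv, hlip, hall⟩

/-- **No splitting with a share above `c_axi(q)`**, every real `q > 1`. [ours] -/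
theorem not_topBotEigSplitting_of_cAxi_lt {q c : ℝ} (hq : 1 < q) (hc : cAxi q < c) :
    ¬ TopBotEigSplitting q c :=
  fun hs => absurd (topBotEigSplitting_share_le_cAxi hq hs) (not_le.mpr hc)

/-- **The share window is two-sided in the kernel for every real `q ≥ 2`**: K10c's share satisfies
`shareConst q ≤ c_axi(q)`. [ours; K10c `topBotEigSplitting_shareConst` + the necessity] -/
theorem shareConst_le_cAxi {q : ℝ} (hq : 2 ≤ q) : shareConst q ≤ cAxi q :=
  topBotEigSplitting_share_le_cAxi (by linarith) (topBotEigSplitting_shareConst hq)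

/-- **Share window, every real `q ≥ 2`**: `0 < shareConst q ≤ c_axi(q)` and every splitting share is
`≤ c_axi(q)`. Search for candidate a priori estimates; no regularity claim. [ours; summary] -/
theorem share_window_cAxi {q : ℝ} (hq : 2 ≤ q) :
    0 < shareConst q ∧ shareConst q ≤ cAxi q ∧ ∀ c : ℝ, TopBotEigSplitting q c → c ≤ cAxi q :=
  ⟨shareConst_pos hq, shareConst_le_cAxi hq, fun _ hs => topBotEigSplitting_share_le_cAxi (by linarith) hs⟩

/-! ## 7. By value: `q = 2`, `q = 4`, `q = 3` -/

/-- `c_axi(2) = 1/3` (the share of K7's pointwise identity at `q = 2`). [ours; by value] -/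
theorem cAxi_two : cAxi 2 = 1 / 3 := by
  have hS : axiS 2 = 5 / 6 := by
    rw [axiS, show (-((2 : ℝ) / 2)) = -1 by norm_num, Real.rpow_neg (by norm_num), Real.rpow_one,
      Real.rpow_two]; norm_num
  have hB : axiB 2 = 1 / 2 := by
    rw [axiB, show (1 : ℝ) - 2 / 2 = 0 by norm_num, Real.rpow_zero]; norm_num
  have hR : axiR 2 = 1 / 12 := by
    rw [axiR, show (1 : ℝ) - 2 = -1 by norm_num, Real.rpow_neg (by norm_num), Real.rpow_one]; norm_num
  rw [cAxi, hS, hB, hR, show ((5 / 6 : ℝ) - 1 / 2) ^ 2 + 4 * (1 / 12) = (2 / 3) ^ 2 by norm_num,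
    Real.sqrt_sq (by norm_num)]
  norm_num

/-- `c_axi(4) = 2/9` (K14's constant). [ours; by value] -/
theorem cAxi_four : cAxi 4 = 2 / 9 := by
  have hS : axiS 4 = 17 / 36 := by
    rw [axiS, show (-((4 : ℝ) / 2)) = -2 by norm_num, Real.rpow_neg (by norm_num), Real.rpow_two,
      show (4 : ℝ) = ((4 : ℕ) : ℝ) by norm_num, Real.rpow_natCast]; norm_num
  have hB : axiB 4 = 1 / 4 := by
    rw [axiB, show (1 : ℝ) - 4 / 2 = -1 by norm_num, Real.rpow_neg (by norm_num), Real.rpow_one]; norm_num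
  have hR : axiR 4 = 1 / 144 := by
    rw [axiR, show (1 : ℝ) - 4 = -3 by norm_num, Real.rpow_neg (by norm_num),
      show (3 : ℝ) = ((3 : ℕ) : ℝ) by norm_num, Real.rpow_natCast]; norm_num
  rw [cAxi, hS, hB, hR, show ((17 / 36 : ℝ) - 1 / 4) ^ 2 + 4 * (1 / 144) = (10 / 36) ^ 2 by norm_num,
    Real.sqrt_sq (by norm_num)]
  norm_num

/-- `c_axi(3) = (5√6 − √22)/24`. [ours; by value] -/
theorem cAxi_three : cAxi 3 = (5 * Real.sqrt 6 - Real.sqrt 22) / 24 := by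
  have h6 : Real.sqrt 6 ^ 2 = 6 := Real.sq_sqrt (by norm_num)
  have h6pos : 0 < Real.sqrt 6 := Real.sqrt_pos.mpr (by norm_num)
  have hhalf : (6 : ℝ) ^ ((1 : ℝ) / 2) = Real.sqrt 6 := (Real.sqrt_eq_rpow 6).symm
  have hS : axiS 3 = Real.sqrt 6 / 4 := by
    rw [axiS, show (-((3 : ℝ) / 2)) = -(1 + 1 / 2) by norm_num, Real.rpow_neg (by norm_num),
      Real.rpow_add (by norm_num), Real.rpow_one, hhalf, show (3 : ℝ) = ((3 : ℕ) : ℝ) by norm_num,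
      Real.rpow_natCast]
    field_simp
    nlinarith [h6]
  have hB : axiB 3 = Real.sqrt 6 / 6 := by
    rw [axiB, show (1 : ℝ) - 3 / 2 = -(1 / 2) by norm_num, Real.rpow_neg (by norm_num), hhalf]
    field_simp
    nlinarith [h6]
  have hR : axiR 3 = 1 / 36 := by
    rw [axiR, show (1 : ℝ) - 3 = -2 by norm_num, Real.rpow_neg (by norm_num), Real.rpow_two]; norm_num
  have hD : (axiS 3 - axiB 3) ^ 2 + 4 * axiR 3 = (Real.sqrt 22 / 12) ^ 2 := by
    rw [hS, hB, hR, div_pow, Real.sq_sqrt (by norm_num)]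
    nlinarith [h6]
  rw [cAxi, hD, Real.sqrt_sq (by positivity), hS, hB]
  ring

/-! ## 8. K14 recovered: the value `q = 4` of the general theorem is K14's statement -/

example {c : ℝ} (hs : TopBotEigSplitting 4 c) : c ≤ 2 / 9 :=
  cAxi_four ▸ topBotEigSplitting_share_le_cAxi (by norm_num) hs

example {c : ℝ} (hs : TopBotEigSplitting 4 c) : c ≤ 2 / 9 := topBotEigSplitting_four_share_le hs

end TopEig

end Summit.NavierStokesRegularity.FunctionalMining

end
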